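import Summits.HodgeConjecture.HodgeConjecture.Theses.GenericDivisibility
import Summits.HodgeConjecture.HodgeConjecture.Theorems.GenericDivisibilityGenericDivisibilityBoundedLevelCleanFunnel
import Summits.HodgeConjecture.HodgeConjecture.Theorems.GenericDivisibilityHodgeClassesGenericallyDivisibleStubCoprimeAssembly
import Summits.HodgeConjecture.HodgeConjecture.Theorems.HodgeClassesGenericallyDivisible.Negative.HodgeType
import Literature.AlgebraicGeometry.HodgeTheory.IntegralLefschetzOneOne
import Literature.AlgebraicGeometry.HodgeTheory.AlgebraicClassesHodgeTypeHolds
import Literature.AlgebraicGeometry.HodgeTheory.HodgeTypeVanishing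
import Literature.AlgebraicGeometry.HodgeTheory.RationalLatticeIntegral
import Literature.AlgebraicGeometry.HodgeTheory.IntegralClassesCountable
import Literature.AlgebraicGeometry.HodgeTheory.SupportedClassesRationalProofs
import Literature.AlgebraicTopology.SingularHomology.IntegralClassRingChange
import HarnessLib

/-!
# Route GenericDivisibility — crux C1 `HodgeClassesGenericallyDivisible` (stmt-HodgeConjecture-18466):
# the surface case EXACTLY — generic `m`-divisibility is "Hodge modulo `m`", and the Hodge-type
# hypothesis of the crux is load-bearing UNCONDITIONALLY

`X` is a smooth projective complex surface (`p = 1` in the crux), `H = H²(X(ℂ); ℤ)`,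
`z ⊗ ℂ = ringChange (ℤ → ℂ) z`, `z| = z|_{(X ∖ Z)(ℂ)}`. For a FIXED `m ≥ 1` say `z ∈ H` is
*generically `m`-divisible* if `m • y = z|_{(X ∖ Z)(ℂ)}` for some Zariski-closed `Z ≠ X` and some
integral class `y` on `(X ∖ Z)(ℂ)` — the conclusion of the crux at `(p, m)`.

## Main results (sorry-free, unconditional)

* `genericDivisibility_one_exists_nsmul_eq_restrict_iff` — **the model theorem of the route at
  `p = 1`**: `z` is generically `m`-divisible **iff** `z - m • v` has complexification of Hodge type
  `(1,1)` for some `v ∈ H`, i.e. iff `z ∈ Hdg²(X, ℤ) + m H`. (`⇐` is C1 at `p = 1`: an integral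
  `(1,1)`-class dies on a non-empty Zariski open, the tree's `integralLefschetzOneOne`; `⇒` is the sharp
  surface form of the companion crux C2: the image of `H → H²((X∖Z)(ℂ); ℤ)` is SATURATED
  (`stub_surfaceSaturation_of_thomNC` + `stub_thomH3TorsionFreeNC`, landed), so `y = v|` on the SAME
  open, and `(z - m • v)|= 0` makes `(z - m • v) ⊗ ℂ` algebraic, hence of type `(1,1)`
  (Voisin I Prop. 11.20, the tree's `isOfHodgeType_of_mem_algebraicClasses_of_isSmoothProjective`).)
  In print this is Grothendieck's `ker (H²(X, μₘ) → H²(ℂ(X), μₘ)) = Pic X / m` (Brauer III, injectivity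
  of `Br X → Br ℂ(X)`) read through the Lefschetz `(1,1)` theorem; Colliot-Thélène–Voisin 2012 §4.1.
* `genericDivisibility_one_forall_pow_of_forall` — if EVERY class of `H` is generically
  `ℓ`-divisible then every class is generically `ℓ^k`-divisible for every `k` (iterate the iff: the
  `(1,1)` parts add up).
* `genericDivisibility_one_ringChange_mem_supportedClasses_of_forall` — if every class of `H` is
  generically `m`-divisible for ONE `m ≥ 2`, then every class of `H²(X(ℂ); ℂ)` coming from `H` has
  coniveau `≥ 1` (`ℓ`-adic closedness of the generically-torsion classes, seat 0's
  `genericDivisibilityBounded_genericallyTorsion_of_forall_pow`, for a prime `ℓ ∣ m`).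
* `genericDivisibility_one_exists_not_divisible_of_isOfHodgeType_zero_two` — hence on a surface
  carrying a non-zero class of type `(0,2)` (any surface with `p_g > 0`), for EVERY `m ≥ 2` some
  integral class is NOT generically `m`-divisible.
* `hodgeClassesGenericallyDivisible_withoutHodgeType_false` — **the crux with its hypothesis
  `IsOfHodgeType … p p` deleted is FALSE, unconditionally** (the standing disprover's
  `…withoutHodgeType_false_of_bounded` had this modulo the open crux C2; the witness surface is the
  smooth quartic of `Negative.HodgeType.exists_surface_class_zero_two_ne_zero`). Sharper:
  `hodgeClassesGenericallyDivisible_withoutHodgeType_false_at` — false already at `p = 1` and at every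
  single `m ≥ 2`.
* `stub_genericallyDivisible_iff_hodgeModM_one` — the registered sub-goal of stmt-HodgeConjecture-18466
  of that name (the iff, closed form).

References: [ColliotTheleneVoisin2012] §4.1; [GrothendieckBrauerIII1968] §1 (Br X ↪ Br ℂ(X));
[VoisinHodgeI2002] Prop. 11.20, Thm. 11.30; [HatcherAT2002] §3.1.
-/

-- `Summit.HodgeConjecture.HodgeConjecture.Theorems` is the mandated namespace (single-problem summit:
-- Problem = Summit), which `linter.dupNamespace` flags on every declaration; the lakefile turns the
-- linter off tree-wide (weak option), restated here so stand-alone elaboration is warning-free too.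
set_option linter.dupNamespace false

noncomputable section

namespace Summit.HodgeConjecture.HodgeConjecture.Theorems

open CategoryTheory AlgebraicGeometry
open Literature.AlgebraicGeometry.Motives Literature.AlgebraicGeometry.HodgeTheory
  Literature.AlgebraicTopology.SingularHomology
open Summit.HodgeConjecture.HodgeConjecture.Theses.GenericDivisibility

/-- Restriction `H^k(X(ℂ);ℤ) → H^k((X∖Z)(ℂ);ℤ)`, the very term of the route decls (notation only). -/
local notation3 (prettyPrint := false) "Res[" X ", " Z ", " k "]" =>
  singularCohomology.map ℤ ℤ
    (⟨Subtype.val, continuous_subtype_val⟩ : C(complexPointsCompl X Z, ComplexPoints X)) k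

/-! ### The model theorem at `p = 1`: generic `m`-divisibility is "Hodge modulo `m`" -/

/-- **Generic `m`-divisibility on a surface, exactly.** For `X` a smooth projective complex surface,
`z ∈ H²(X(ℂ); ℤ)` and `m ≥ 1`: there are a Zariski-closed `Z ≠ X` and an integral class `y` on
`(X ∖ Z)(ℂ)` with `m • y = z|_{(X ∖ Z)(ℂ)}` **iff** `(z - m • v) ⊗ ℂ` is of Hodge type `(1,1)` for some
`v ∈ H²(X(ℂ); ℤ)`. `⇒`: saturation of the image of `H²(X(ℂ);ℤ)` in `H²((X∖Z)(ℂ);ℤ)` gives `y = v|`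
on the same open, so `(z - m • v)|= 0`, so `(z - m • v) ⊗ ℂ` is algebraic, so of type `(1,1)`;
`⇐`: the integral Lefschetz `(1,1)` theorem kills `z - m • v` on a non-empty Zariski open, where then
`z| = m • v|`. [cite: ColliotTheleneVoisin2012, §4.1] [cite: VoisinHodgeI2002, Prop. 11.20 and Thm. 11.30] -/
theorem genericDivisibility_one_exists_nsmul_eq_restrict_iff {X : SchemeOver ℂ}
    (hX : IsSmoothProjective (2 * 1) X) (z : singularCohomology ℤ ℤ (ComplexPoints X) (2 * 1))
    {m : ℕ} (hm : 1 ≤ m) :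
    (∃ Z : Set X.left, IsClosed Z ∧ Z ≠ Set.univ ∧
        ∃ y : singularCohomology ℤ ℤ (complexPointsCompl X Z) (2 * 1), m • y = Res[X, Z, 2 * 1] z) ↔
      ∃ v : singularCohomology ℤ ℤ (ComplexPoints X) (2 * 1),
        IsOfHodgeType (2 * 1) X (2 * 1) 1 1
          (singularCohomology.ringChange (Int.castRingHom ℂ) (ComplexPoints X) (2 * 1) (z - m • v)) := by
  haveI : IsIntegral X.left := IsSmoothProjective.isIntegral_holds hX
  constructor
  · rintro ⟨Z, hZ, hZne, y, hy⟩
    -- saturation on the SAME open: `y = v|`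
    obtain ⟨v, hv⟩ := stub_surfaceSaturation_of_thomNC
      (fun S hS hSc hdisj hflat hnc ↦ stub_thomH3TorsionFreeNC S hS hSc hdisj hflat hnc)
      hX Z hZ hZne y m hm ⟨z, hy.symm⟩
    refine ⟨v, ?_⟩
    -- `(z - m • v)|= 0`
    have h0 : restrictToCompl ℤ X (2 * 1) Z (z - m • v) = 0 := by
      change Res[X, Z, 2 * 1] (z - m • v) = 0
      rw [map_sub, map_nsmul, hv, hy, sub_self]
    -- so `(z - m • v) ⊗ ℂ` is algebraic, hence of type `(1,1)`
    have hr : ∀ x ∈ Z, ((1 : ℕ) : ℕ∞) ≤ Order.coheight x :=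
      (forall_one_le_coheight_iff_ne_univ hZ).2 hZne
    refine isOfHodgeType_of_mem_algebraicClasses_of_isSmoothProjective hX 1 ?_
    refine mem_coniveauFiltration_of_restrictToCompl_eq_zero ℂ (2 * 1) hZ hr ?_
    change singularCohomology.map ℂ ℂ _ (2 * 1)
      (singularCohomology.ringChange (Int.castRingHom ℂ) (ComplexPoints X) (2 * 1) (z - m • v)) = 0
    rw [← singularCohomology.ringChange_map]
    change singularCohomology.ringChange (Int.castRingHom ℂ) (complexPointsCompl X Z) (2 * 1)
      (restrictToCompl ℤ X (2 * 1) Z (z - m • v)) = 0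
    rw [h0, map_zero]
  · rintro ⟨v, hv⟩
    obtain ⟨Z, hZ, hZne, h0⟩ := integralLefschetzOneOne hX (z - m • v) hv
    refine ⟨Z, hZ, hZne, Res[X, Z, 2 * 1] v, ?_⟩
    have h0' : Res[X, Z, 2 * 1] (z - m • v) = 0 := h0
    rw [map_sub, map_nsmul, sub_eq_zero] at h0'
    exact h0'.symm

/-! ### Iterating: one level of divisibility for all classes gives all levels -/

/-- **One step up the `ℓ`-adic tower.** If every class is generically `ℓ`-divisible (`ℓ ≥ 1`), then
for every `k` every `z` is `ℓ^k • v` plus a class whose complexification is of type `(1,1)`: from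
`z - ℓ^k • v` and `v - ℓ • v'` of type `(1,1)` after `⊗ ℂ`, so is
`z - ℓ^{k+1} • v' = (z - ℓ^k • v) + ℓ^k • (v - ℓ • v')`. [cite: VoisinHodgeI2002, §7.1.1] -/
theorem genericDivisibility_one_exists_sub_pow_nsmul_oneOne {X : SchemeOver ℂ}
    (hX : IsSmoothProjective (2 * 1) X) {ℓ : ℕ} (hℓ : 1 ≤ ℓ)
    (h : ∀ z : singularCohomology ℤ ℤ (ComplexPoints X) (2 * 1),
      ∃ Z : Set X.left, IsClosed Z ∧ Z ≠ Set.univ ∧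
        ∃ y : singularCohomology ℤ ℤ (complexPointsCompl X Z) (2 * 1), ℓ • y = Res[X, Z, 2 * 1] z)
    (k : ℕ) (z : singularCohomology ℤ ℤ (ComplexPoints X) (2 * 1)) :
    ∃ v : singularCohomology ℤ ℤ (ComplexPoints X) (2 * 1),
      IsOfHodgeType (2 * 1) X (2 * 1) 1 1
        (singularCohomology.ringChange (Int.castRingHom ℂ) (ComplexPoints X) (2 * 1) (z - ℓ ^ k • v)) := by
  induction k generalizing z with
  | zero =>
    obtain ⟨A⟩ := (nonempty_hodgeModel_holds (n := 2 * 1) (X := X)).nonempty hX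
    refine ⟨z, ?_⟩
    rw [pow_zero, one_smul, sub_self, map_zero]
    exact IsOfHodgeType.zero A _ _ _
  | succ k ih =>
    obtain ⟨v, hv⟩ := ih z
    obtain ⟨v', hv'⟩ := (genericDivisibility_one_exists_nsmul_eq_restrict_iff hX v hℓ).1 (h v)
    refine ⟨v', ?_⟩
    have hdec : z - ℓ ^ (k + 1) • v' = (z - ℓ ^ k • v) + ℓ ^ k • (v - ℓ • v') := by
      rw [nsmul_sub, ← mul_nsmul', ← pow_succ, sub_add_sub_cancel]
    have hsm := hv'.smul ((ℓ ^ k : ℕ) : ℂ)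
    rw [Nat.cast_smul_eq_nsmul] at hsm
    rw [hdec, map_add, map_nsmul]
    exact hv.add hX hsm


/-- **If every class of `H²(X(ℂ);ℤ)` is generically `ℓ`-divisible, every class is generically
`ℓ^k`-divisible** (`X` a smooth projective surface, `ℓ ≥ 1`, all `k`): by the model theorem
`z = d₁ + ℓ v₁`, `v₁ = d₂ + ℓ v₂`, … with `dᵢ ⊗ ℂ` of type `(1,1)`, so
`z - ℓ^k vₖ = d₁ + ℓ d₂ + ⋯ + ℓ^{k-1} d_k` is again of type `(1,1)` after `⊗ ℂ`.
[cite: ColliotTheleneVoisin2012, §4.1] [cite: VoisinHodgeI2002, §7.1.1] -/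
theorem genericDivisibility_one_forall_pow_of_forall {X : SchemeOver ℂ}
    (hX : IsSmoothProjective (2 * 1) X) {ℓ : ℕ} (hℓ : 1 ≤ ℓ)
    (h : ∀ z : singularCohomology ℤ ℤ (ComplexPoints X) (2 * 1),
      ∃ Z : Set X.left, IsClosed Z ∧ Z ≠ Set.univ ∧
        ∃ y : singularCohomology ℤ ℤ (complexPointsCompl X Z) (2 * 1), ℓ • y = Res[X, Z, 2 * 1] z)
    (k : ℕ) (z : singularCohomology ℤ ℤ (ComplexPoints X) (2 * 1)) :
    ∃ Z : Set X.left, IsClosed Z ∧ Z ≠ Set.univ ∧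
      ∃ y : singularCohomology ℤ ℤ (complexPointsCompl X Z) (2 * 1), ℓ ^ k • y = Res[X, Z, 2 * 1] z := by
  obtain ⟨v, hv⟩ := genericDivisibility_one_exists_sub_pow_nsmul_oneOne hX hℓ h k z
  exact (genericDivisibility_one_exists_nsmul_eq_restrict_iff hX z (Nat.one_le_pow _ _ hℓ)).2 ⟨v, hv⟩

/-! ### One `m ≥ 2` for all classes forces coniveau `≥ 1` for all classes -/

/-- **If every class of `H²(X(ℂ);ℤ)` is generically `m`-divisible for ONE `m ≥ 2`, every class has
complexification of coniveau `≥ 1`** (`X` a smooth projective surface). Take a prime `ℓ ∣ m`: every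
class is generically `ℓ`-divisible, hence for every `n` one has `z - ℓ^{n+1} • wₙ` of type `(1,1)`
after `⊗ ℂ` (proof of `genericDivisibility_one_forall_pow_of_forall`), which dies on a non-empty
Zariski open (integral Lefschetz `(1,1)`); the generically-torsion classes are `ℓ`-adically closed in
the finitely generated `H²(X(ℂ);ℤ)` (`genericDivisibilityBounded_genericallyTorsion_of_forall_pow`,
Krull), so `z` itself is generically torsion, and `GT ⊗ ℂ ⊆ N¹`.
[cite: ColliotTheleneVoisin2012, §4.1] [cite: VoisinHodgeI2002, Thm. 11.30] -/
theorem genericDivisibility_one_ringChange_mem_supportedClasses_of_forall {X : SchemeOver ℂ}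
    (hX : IsSmoothProjective (2 * 1) X) {m : ℕ} (hm : 2 ≤ m)
    (h : ∀ z : singularCohomology ℤ ℤ (ComplexPoints X) (2 * 1),
      ∃ Z : Set X.left, IsClosed Z ∧ Z ≠ Set.univ ∧
        ∃ y : singularCohomology ℤ ℤ (complexPointsCompl X Z) (2 * 1), m • y = Res[X, Z, 2 * 1] z)
    (z : singularCohomology ℤ ℤ (ComplexPoints X) (2 * 1)) :
    singularCohomology.ringChange (Int.castRingHom ℂ) (ComplexPoints X) (2 * 1) z ∈
      supportedClasses X (2 * 1) 1 := by
  -- a prime `ℓ ∣ m`; every class is generically `ℓ`-divisible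
  set ℓ := m.minFac with hℓdef
  have hℓ : ℓ.Prime := Nat.minFac_prime (by omega)
  obtain ⟨c, hc⟩ : ℓ ∣ m := Nat.minFac_dvd m
  have hℓdiv : ∀ z : singularCohomology ℤ ℤ (ComplexPoints X) (2 * 1),
      ∃ Z : Set X.left, IsClosed Z ∧ Z ≠ Set.univ ∧
        ∃ y : singularCohomology ℤ ℤ (complexPointsCompl X Z) (2 * 1), ℓ • y = Res[X, Z, 2 * 1] z := by
    intro z
    obtain ⟨Z, hZ, hZne, y, hy⟩ := h z
    refine ⟨Z, hZ, hZne, c • y, ?_⟩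
    rw [← mul_nsmul', ← hc, hy]
  -- hence `z ≡ ℓ^{n+1} wₙ` modulo classes dying on a non-empty Zariski open, for every `n`
  have hall : ∀ n : ℕ, ∃ w : singularCohomology ℤ ℤ (ComplexPoints X) (2 * 1), ∃ Z : Set X.left,
      IsClosed Z ∧ Z ≠ Set.univ ∧ ∃ N : ℕ, 1 ≤ N ∧ N • Res[X, Z, 2 * 1] (z - ℓ ^ (n + 1) • w) = 0 := by
    intro n
    obtain ⟨w, hw⟩ := genericDivisibility_one_exists_sub_pow_nsmul_oneOne hX hℓ.one_lt.le hℓdiv (n + 1) z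
    obtain ⟨Z, hZ, hZne, h0⟩ := integralLefschetzOneOne hX (z - ℓ ^ (n + 1) • w) hw
    exact ⟨w, Z, hZ, hZne, 1, le_rfl, by rw [one_smul]; exact h0⟩
  exact genericDivisibilityBounded_ringChange_mem_supportedClasses hX
    (genericDivisibilityBounded_genericallyTorsion_of_forall_pow hX hℓ.two_le hall)

/-! ### The Hodge-type hypothesis of the crux is load-bearing, unconditionally -/

/-- **On a surface with a non-zero class of type `(0,2)`, for every `m ≥ 2` some integral class is not
generically `m`-divisible.** Otherwise every class of `H²(X(ℂ);ℤ)` has complexification of coniveau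
`≥ 1` (`genericDivisibility_one_ringChange_mem_supportedClasses_of_forall`); integral classes span
`H²(X(ℂ); ℂ)` over `ℂ` (`span_isRationalClass_eq_top_of_isSmoothProjective_holds` +
`IsRationalClass.exists_nsmul_isIntegralClass`), so `N¹ H² = H²`, and a class of type `(0,2)` of
coniveau `≥ 1` vanishes (Grothendieck 1969 / Deligne, the tree's theorem
`Grothendieck1969_supportedClasses_le_hodgeConiveau_holds`). [cite: GrothendieckTopology1969, p. 300]
[cite: ColliotTheleneVoisin2012, §4.1] -/
theorem genericDivisibility_one_exists_not_divisible_of_isOfHodgeType_zero_two {X : SchemeOver ℂ}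
    (hX : IsSmoothProjective (2 * 1) X) {c : complexBetti X 2} (hc : IsOfHodgeType 2 X 2 0 2 c)
    (hc0 : c ≠ 0) {m : ℕ} (hm : 2 ≤ m) :
    ∃ z : singularCohomology ℤ ℤ (ComplexPoints X) (2 * 1),
      ¬ ∃ Z : Set X.left, IsClosed Z ∧ Z ≠ Set.univ ∧
        ∃ y : singularCohomology ℤ ℤ (complexPointsCompl X Z) (2 * 1), m • y = Res[X, Z, 2 * 1] z := by
  by_contra hcon
  push Not at hcon
  have h1 : ∀ z : singularCohomology ℤ ℤ (ComplexPoints X) (2 * 1),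
      singularCohomology.ringChange (Int.castRingHom ℂ) (ComplexPoints X) (2 * 1) z ∈
        supportedClasses X (2 * 1) 1 :=
    fun z ↦ genericDivisibility_one_ringChange_mem_supportedClasses_of_forall hX hm hcon z
  have hY : IsSmoothProjective 2 X := hX
  -- every class of `H²(X(ℂ); ℂ)` has coniveau `≥ 1`
  have htop : supportedClasses X 2 1 = ⊤ := by
    refine eq_top_iff.2 ?_
    rw [← span_isRationalClass_eq_top_of_isSmoothProjective_holds 2 X hY 2]
    refine Submodule.span_le.2 fun a ha ↦ ?_
    obtain ⟨N, hN, hNa⟩ := IsRationalClass.exists_nsmul_isIntegralClass hY ha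
    obtain ⟨z, hz⟩ := (isIntegralClass_iff_mem_range_ringChange _).1 hNa
    have hmem : (N : ℂ) • a ∈ supportedClasses X 2 1 := hz ▸ h1 z
    have hNa' : a = (N : ℂ)⁻¹ • ((N : ℂ) • a) := by
      rw [smul_smul, inv_mul_cancel₀ (by exact_mod_cast hN.ne'), one_smul]
    rw [SetLike.mem_coe, hNa']
    exact Submodule.smul_mem _ _ hmem
  exact hc0 (Grothendieck1969_supportedClasses_le_hodgeConiveau_holds.eq_zero_of_isOfHodgeType hY
    (show 0 + 2 = 2 from rfl) (Or.inl Nat.one_pos) (htop ▸ Submodule.mem_top) hc)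

/-- **The crux C1 with its Hodge-type hypothesis deleted is false already at `p = 1` and at every
single `m ≥ 2`**: on the smooth quartic surface of
`Negative.HodgeType.exists_surface_class_zero_two_ne_zero` (a non-zero class of type `(0,2)`), some
integral class of degree `2` is not generically `m`-divisible. Unconditional (the disprover's
`…withoutHodgeType_false_of_bounded` assumed the open crux C2; here C2 is only needed — and is a
theorem of the tree — at `p = 1`). [cite: ColliotTheleneVoisin2012, §4.1]
[cite: VoisinHodgeII2003, §6.1.3 and Cor. 6.12] -/
theorem hodgeClassesGenericallyDivisible_withoutHodgeType_false_at {m : ℕ} (hm : 2 ≤ m) :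
    ¬ (∀ ⦃X : SchemeOver ℂ⦄, IsSmoothProjective (2 * 1) X →
        ∀ z : singularCohomology ℤ ℤ (ComplexPoints X) (2 * 1),
          ∃ Z : Set X.left, IsClosed Z ∧ Z ≠ Set.univ ∧
            ∃ y : singularCohomology ℤ ℤ (complexPointsCompl X Z) (2 * 1),
              m • y = Res[X, Z, 2 * 1] z) := by
  intro h
  obtain ⟨Y, hY, c, hc, hc0⟩ := HodgeClassesGenericallyDivisible.Negative.HodgeType.exists_surface_class_zero_two_ne_zero
  obtain ⟨z, hz⟩ := genericDivisibility_one_exists_not_divisible_of_isOfHodgeType_zero_two hY hc hc0 hm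
  exact hz (h hY z)

/-- **The crux C1 `HodgeClassesGenericallyDivisible` WITHOUT its hypothesis `IsOfHodgeType … p p` is
FALSE, unconditionally**: the statement below is the route decl verbatim with that hypothesis deleted;
it fails at `p = 1`, `m = 2` on a smooth quartic surface. So any proof of the crux must use the Hodge
type of `z` (at `p = 1` the crux is exactly the integral Lefschetz `(1,1)` theorem, by
`genericDivisibility_one_exists_nsmul_eq_restrict_iff`). [cite: ColliotTheleneVoisin2012, §4.1]
[cite: VoisinHodgeI2002, Thm. 11.30] -/
theorem hodgeClassesGenericallyDivisible_withoutHodgeType_false :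
    ¬ (∀ ⦃p : ℕ⦄ ⦃X : SchemeOver ℂ⦄, 1 ≤ p → IsSmoothProjective (2 * p) X →
        ∀ z : singularCohomology ℤ ℤ (ComplexPoints X) (2 * p),
          ∀ m : ℕ, 1 ≤ m → ∃ Z : Set X.left, IsClosed Z ∧ Z ≠ Set.univ ∧
            ∃ y : singularCohomology ℤ ℤ (complexPointsCompl X Z) (2 * p),
              m • y = singularCohomology.map ℤ ℤ
                (⟨Subtype.val, continuous_subtype_val⟩ :
                  C(complexPointsCompl X Z, ComplexPoints X)) (2 * p) z) := by
  intro h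
  exact hodgeClassesGenericallyDivisible_withoutHodgeType_false_at le_rfl
    fun X hX z ↦ h (p := 1) le_rfl hX z 2 (by norm_num)

/-! ### C1 at `p = 1` once more, as the `v = 0` instance of the model theorem -/

/-- **C1 at `p = 1`** as the instance `v = 0` of the model theorem: a class whose complexification is
of type `(1,1)` is generically `m`-divisible for every `m ≥ 1` (indeed generically zero).
[cite: VoisinHodgeI2002, Thm. 11.30] -/
theorem genericDivisibility_one_exists_nsmul_eq_restrict_of_isOfHodgeType {X : SchemeOver ℂ}
    (hX : IsSmoothProjective (2 * 1) X) (z : singularCohomology ℤ ℤ (ComplexPoints X) (2 * 1))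
    (hz : IsOfHodgeType (2 * 1) X (2 * 1) 1 1
      (singularCohomology.ringChange (Int.castRingHom ℂ) (ComplexPoints X) (2 * 1) z))
    {m : ℕ} (hm : 1 ≤ m) :
    ∃ Z : Set X.left, IsClosed Z ∧ Z ≠ Set.univ ∧
      ∃ y : singularCohomology ℤ ℤ (complexPointsCompl X Z) (2 * 1), m • y = Res[X, Z, 2 * 1] z :=
  (genericDivisibility_one_exists_nsmul_eq_restrict_iff hX z hm).2 ⟨0, by rwa [smul_zero, sub_zero]⟩

/-! ### The registered sub-goal -/

/-- **Registered sub-goal `stub_genericallyDivisible_iff_hodgeModM_one` of stmt-HodgeConjecture-18466**: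
the model theorem of the route at `p = 1`, closed form — on a smooth projective complex surface an
integral class of degree `2` is generically `m`-divisible (`m ≥ 1`) iff it is an integral Hodge
`(1,1)` class modulo `m • H²(X(ℂ);ℤ)`. [cite: ColliotTheleneVoisin2012, §4.1]
[cite: VoisinHodgeI2002, Prop. 11.20 and Thm. 11.30] -/
theorem stub_genericallyDivisible_iff_hodgeModM_one :
    ∀ ⦃X : SchemeOver ℂ⦄, IsSmoothProjective (2 * 1) X →
      ∀ (z : singularCohomology ℤ ℤ (ComplexPoints X) (2 * 1)) (m : ℕ), 1 ≤ m →
        ((∃ Z : Set X.left, IsClosed Z ∧ Z ≠ Set.univ ∧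
            ∃ y : singularCohomology ℤ ℤ (complexPointsCompl X Z) (2 * 1),
              m • y = singularCohomology.map ℤ ℤ
                (⟨Subtype.val, continuous_subtype_val⟩ :
                  C(complexPointsCompl X Z, ComplexPoints X)) (2 * 1) z) ↔
          ∃ v : singularCohomology ℤ ℤ (ComplexPoints X) (2 * 1),
            IsOfHodgeType (2 * 1) X (2 * 1) 1 1
              (singularCohomology.ringChange (Int.castRingHom ℂ) (ComplexPoints X) (2 * 1)
                (z - m • v))) :=
  fun _ hX z _ hm ↦ genericDivisibility_one_exists_nsmul_eq_restrict_iff hX z hm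

end Summit.HodgeConjecture.HodgeConjecture.Theorems

end
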